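import Mathlib.Analysis.SpecialFunctions.Log.Deriv
import Mathlib.Analysis.Complex.ExponentialBounds
import HarnessLib

/-!
# Six-decimal ceilings of `log 2, log 3, log 4, log 5, log 7, log 9` (admissibility side conditions of
# the GRH arm's format-D certificates)

Cell `rh-explicit`, WEIL TRACK — GRH ARM (`Summits/Ventures/WeilGRH/`).  A format-D (dual-multiplier)
certificate for a rung `t = (log n₀)/2` places its atoms at `x − reach ≥ ⌈log n₀⌉_{10⁻⁶}` (the band edge
`2t = log n₀` rounded UP to six decimals), so the admissibility hypothesis `2t + reach ≤ x` of
`DualCertificateSoundness.le_re_weilQuadraticChar_of_dual_nonneg` needs, once per rung value, the real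
inequality `log n₀ ≤ ⌈log n₀⌉_{10⁻⁶}` — with margins between `8.8·10⁻⁸` (`log 5`) and `8.5·10⁻⁷`
(`log 7`).  This file proves the six ceilings used by the deposited certificates
(`n₀ = 2, 3, 4, 5, 7, 9`): `log 2 ≤ 0.693148` (Mathlib's `Real.log_two_lt_d9`), `log 4 ≤ 1.386295`,
`log 3 ≤ 1.098613` and `log 9 ≤ 2.197225` (from `log 3 = 2 log 2 + log(1 − 1/4)` and twelve terms of
the logarithmic series with Mathlib's remainder bound `Real.abs_log_sub_add_sum_range_le`),
`log 5 ≤ 1.609438` (`log 5 = 2 log 2 + log(1 + 1/4)`), `log 7 ≤ 1.945911` (`log 7 = 3 log 2 + log(1 − 1/8)`),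
each also in the sharper form actually obtained.  Everything is proved; no facts.
-/

noncomputable section

open Real Finset

namespace Summit.Ventures.WeilGRH

/-- `log 2 ≤ 0.693148`. [folklore] -/
theorem log_two_le_ceil6 : Real.log 2 ≤ 693148 / 1000000 := by
  have h := Real.log_two_lt_d9
  linarith

/-- `log 4 ≤ 1.386295`. [folklore] -/
theorem log_four_le_ceil6 : Real.log 4 ≤ 1386295 / 1000000 := by
  have h := Real.log_two_lt_d9
  rw [show (4 : ℝ) = 2 ^ 2 by norm_num, Real.log_pow]
  push_cast
  linarith

/-- `log 3 ≤ 1.09861232` (twelve terms of `−log(1 − 1/4) = Σ (1/4)^k/k`). [folklore] -/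
theorem log_three_le : Real.log 3 ≤ 109861232 / 100000000 := by
  have h := Real.abs_log_sub_add_sum_range_le (show |(1 / 4 : ℝ)| < 1 by
    rw [abs_of_pos (by norm_num)]; norm_num) 12
  have h2 := Real.log_two_lt_d9
  have hsplit : Real.log 3 = 2 * Real.log 2 + Real.log (1 - 1 / 4) := by
    rw [show (1 - 1 / 4 : ℝ) = 3 / 4 by norm_num, Real.log_div (by norm_num) (by norm_num),
      show (4 : ℝ) = 2 ^ 2 by norm_num, Real.log_pow]
    push_cast
    ring
  rw [hsplit]
  have hS := (abs_le.1 h).2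
  simp only [Finset.sum_range_succ, Finset.sum_range_zero] at hS
  rw [abs_of_pos (by norm_num : (0 : ℝ) < 1 / 4)] at hS
  norm_num at hS ⊢
  linarith

/-- `log 3 ≤ 1.098613`. [folklore] -/
theorem log_three_le_ceil6 : Real.log 3 ≤ 1098613 / 1000000 :=
  log_three_le.trans (by norm_num)

/-- `log 9 ≤ 2.197225`. [folklore] -/
theorem log_nine_le_ceil6 : Real.log 9 ≤ 2197225 / 1000000 := by
  have h := log_three_le
  rw [show (9 : ℝ) = 3 ^ 2 by norm_num, Real.log_pow]
  push_cast
  linarith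

/-- `log 5 ≤ 1.60943794` (twelve terms of `log(1 + 1/4) = −Σ (−1/4)^k/k`). [folklore] -/
theorem log_five_le : Real.log 5 ≤ 160943794 / 100000000 := by
  have h := Real.abs_log_sub_add_sum_range_le (show |(-(1 / 4) : ℝ)| < 1 by
    rw [abs_neg, abs_of_pos (by norm_num)]; norm_num) 12
  have h2 := Real.log_two_lt_d9
  have hsplit : Real.log 5 = 2 * Real.log 2 + Real.log (1 - -(1 / 4)) := by
    rw [show (1 - -(1 / 4) : ℝ) = 5 / 4 by norm_num, Real.log_div (by norm_num) (by norm_num),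
      show (4 : ℝ) = 2 ^ 2 by norm_num, Real.log_pow]
    push_cast
    ring
  rw [hsplit]
  have hS := (abs_le.1 h).2
  simp only [Finset.sum_range_succ, Finset.sum_range_zero] at hS
  rw [abs_neg, abs_of_pos (by norm_num : (0 : ℝ) < 1 / 4)] at hS
  norm_num at hS ⊢
  linarith

/-- `log 5 ≤ 1.609438`. [folklore] -/
theorem log_five_le_ceil6 : Real.log 5 ≤ 1609438 / 1000000 :=
  log_five_le.trans (by norm_num)

/-- `log 7 ≤ 1.94591016` (eight terms of `−log(1 − 1/8) = Σ (1/8)^k/k`). [folklore] -/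
theorem log_seven_le : Real.log 7 ≤ 194591016 / 100000000 := by
  have h := Real.abs_log_sub_add_sum_range_le (show |(1 / 8 : ℝ)| < 1 by
    rw [abs_of_pos (by norm_num)]; norm_num) 8
  have h2 := Real.log_two_lt_d9
  have hsplit : Real.log 7 = 3 * Real.log 2 + Real.log (1 - 1 / 8) := by
    rw [show (1 - 1 / 8 : ℝ) = 7 / 8 by norm_num, Real.log_div (by norm_num) (by norm_num),
      show (8 : ℝ) = 2 ^ 3 by norm_num, Real.log_pow]
    push_cast
    ring
  rw [hsplit]
  have hS := (abs_le.1 h).2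
  simp only [Finset.sum_range_succ, Finset.sum_range_zero] at hS
  rw [abs_of_pos (by norm_num : (0 : ℝ) < 1 / 8)] at hS
  norm_num at hS ⊢
  linarith

/-- `log 7 ≤ 1.945911`. [folklore] -/
theorem log_seven_le_ceil6 : Real.log 7 ≤ 1945911 / 1000000 :=
  log_seven_le.trans (by norm_num)

end Summit.Ventures.WeilGRH

end
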